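import Summits.QuantumFields.YangMills.Theorems.BalabanUVNodesPortS1P0CMobiusInt
import Summits.QuantumFields.YangMills.Theorems.BalabanUVNodesPortS1LZdetTwinBridge
import Summits.QuantumFields.YangMills.Theorems.BalabanUVNodesPortS1G3CTwinGeom

/-!
# NODE O port — `stub_P0C` (the guarded P0-ℂ letter `P0HolExtAtRecordGL`), brick G: THE (Z-bridge) OF THE MÖBIUS PIECES FROM A FAMILY-LEVEL BRIDGE
# (memo `Cruxes/PortRecordRepresentationS1/Lines/pta_residueW-stub_P0C-hand.md` §2 (P1), §4 (M6); over ✓`…PortS1P0CMobius` ∕ ✓`…PortS1P0CMobiusInt` and ▶ PTA-1's cover kit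
# ✓`…PortS1LZdetTwinGeomK` ∕ ✓`…PortS1LZdetTwinBridge` ∕ ✓`…PortS1G3CTwinGeom`)

Porter hand `hand-27930-P0C` (g0), `--supports stmt-QuantumFields-27930 --as helper`; count-neutral.  [I] = [Balaban1987RG1].

WHY.  The interface ✓`p0CarrierClauses_of_family` (brick F) leaves the (Z-bridge) of `P0CarrierClauses` — «off the centred wrap class, on the window of `X̂_K(Y)`, the torus piece `TY n Y`
read at covered indices IS the integer piece `TZY (X̂_K(Y))` read at the pulled-back pair» — as a PIECE-level hypothesis.  This file derives it from the natural FAMILY-level statement «the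
torus localized kernel `T_Y` at covered indices of the window of `Y` is the integer localized kernel `TZ_{X̂_K(Y)}` at the pull-back» ([I] (1.21): the torus terms are the periodisations of
the `ℤ^d` terms) plus the two support clauses, by matching the two Möbius recursions along the poset isomorphism `{Y′ ∈ 𝐃 : Y′ ⊆ Y} ≅ {X̂′ non-empty face-connected : X̂′ ⊆ X̂_K(Y)}`,
`Y′ ↦ X̂_K(Y′)` (off the wrap class the centred lift inverts the cover: ✓`image_proj_image_valMinAbs`, ✓`subset_of_intCubes_subset`, ✓`not_mem_recordWrapCtr_of_subset`; the lift of a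
wall-connected off-seam family is face-connected: `faceConnected_intCubes_of_not_mem_recordWrapCtr` below).

WHAT THIS FILE PROVES (sorry-free): `tadj_lift_of_ne_half` ∕ `linked_intCubes_of_tLinked` ∕ ★ `faceConnected_intCubes_of_not_mem_recordWrapCtr` (+ `intCubes_nonempty`,
`intCubes_mem_p0cIntDom`); `blockMap_mem_intCubes_of_embIter_mem_domSites` (a covered index read by the piece of `Y′` has its block in `X̂_K(Y′)`); `sum_below_intCubes_eq_sum_ssubsets` and
`sum_belowInt_eq_sum_ssubsets` (the two strict down-sets enumerate the same sets); ★★ `p0cPiece_bridge` — the (Z-bridge) row of `P0CarrierClauses` for `(p0cPiece T, p0cIntPiece TZ)` from the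
family-level bridge + (P4-b) for `T` + (Z-supp) for `TZ`.

HONEST FRAMING.  Index bookkeeping; NO estimate; nothing of Bałaban asserted, ported or discharged; `stub_P0C` NOT closed; ⟨27930⟩ OPEN; NODE O 0∕1; COUNT 8∕28 · K 1∕4 UNMOVED; finite
`𝕋⁴_{L^K}` at fixed ε — NOT continuum ∕ OS ∕ Clay; **the Yang–Mills mass gap is NOT proved by any of this.**  No `sorry`, no `instance`, no `notation`, no `def`; standard axioms.
-/

noncomputable section

open scoped BigOperators
open Finset

namespace Summit.QuantumFields.YangMills.Theorems.BalabanUVNodesPortS1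

open Summit.QuantumFields.YangMills.Theorems.K0RecordFormatNames
open Literature.MathematicalPhysics.QuantumFieldTheory.Balaban1983to89
open Literature.MathematicalPhysics.QuantumFieldTheory.Balaban1983to89.Node00
open Literature.MathematicalPhysics.QuantumFieldTheory.Balaban1983to89.T4Continuum (T4Family)
open Literature.MathematicalPhysics.QuantumFieldTheory.Balaban1983to89.TreeLengthTorus (TPt IsTDom proj TAdj TStepIn TLinked TFaceConnected tFaceConnected_image)
open Literature.MathematicalPhysics.QuantumLattice (blockMap)

variable {F : T4Family}

/-! ## §1  Off the centred wrap class the centred lift of a domain is face-connected -/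

section Lift

/-- One wall step of the torus between two cubes OFF THE SEAM lifts to one wall step of `ℤ⁴` between their centred representatives.
[cite: Balaban1987RG1, p.257 (localization domains), (1.21) p.264 (bookkeeping)] -/
theorem tadj_lift_of_ne_half {q : ℕ} [NeZero q] {c c' : TPt 4 q} (h : TAdj c c')
    (hc : ∀ i, (c i).valMinAbs ≠ ((q / 2 : ℕ) : ℤ)) (hc' : ∀ i, (c' i).valMinAbs ≠ ((q / 2 : ℕ) : ℤ)) :
    B13ScaleTransfer.Adj (fun i => (c i).valMinAbs) (fun i => (c' i).valMinAbs) := by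
  obtain ⟨i, h | h⟩ := h
  · refine ⟨i, Or.inl ?_⟩
    funext j
    by_cases hj : j = i
    · subst hj
      rw [Function.update_self, h, Function.update_self, valMinAbs_add_one_of_ne_half _ (hc j)]
    · rw [Function.update_of_ne hj, h, Function.update_of_ne hj]
  · refine ⟨i, Or.inr ?_⟩
    funext j
    by_cases hj : j = i
    · subst hj
      rw [Function.update_self, h, Function.update_self, valMinAbs_add_one_of_ne_half _ (hc' j)]
    · rw [Function.update_of_ne hj, h, Function.update_of_ne hj]

/-- A wall chain inside an off-seam family lifts to a wall chain inside its centred lift. [cite: Balaban1987RG1, p.257 (bookkeeping)] -/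
theorem linked_lift_of_tLinked {q : ℕ} [NeZero q] {S : Finset (TPt 4 q)} (hS : ∀ c ∈ S, ∀ i, (c i).valMinAbs ≠ ((q / 2 : ℕ) : ℤ))
    {x y : TPt 4 q} (h : TLinked S x y) :
    B13ScaleTransfer.Linked (S.image fun c i => (c i).valMinAbs) (fun i => (x i).valMinAbs) (fun i => (y i).valMinAbs) := by
  unfold TLinked at h
  unfold B13ScaleTransfer.Linked
  induction h with
  | refl => exact Relation.ReflTransGen.refl
  | tail _ hbc ih =>
      exact ih.tail ⟨Finset.mem_image_of_mem _ hbc.1, Finset.mem_image_of_mem _ hbc.2.1, tadj_lift_of_ne_half hbc.2.2 (hS _ hbc.1) (hS _ hbc.2.1)⟩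

/-- ★ **OFF THE CENTRED WRAP CLASS, `X̂_K(X)` IS FACE-CONNECTED** (no cube of `X` meets the antipodal seam, so every wall step of `X` lifts).
[cite: Balaban1987RG1, p.257 (localization domains), (1.21) p.264] -/
theorem faceConnected_intCubes_of_not_mem_recordWrapCtr {Mc k K : ℕ} {X : (recordDomSys F Mc k K).Dom} (hX : X ∉ recordWrapCtr F Mc k K) :
    B13ScaleTransfer.FaceConnected (intCubes F Mc k K X) := by
  have hS : ∀ c ∈ (X.1 : Finset (TPt (F.P K).d (Sect2.domCount (F.P K) Mc (k + 1)))), ∀ i, (c i).valMinAbs ≠ ((Sect2.domCount (F.P K) Mc (k + 1) / 2 : ℕ) : ℤ) := by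
    intro c hc i hi
    exact hX ((mem_recordWrapCtr_iff F Mc k K X).2 ⟨c, hc, i, hi⟩)
  intro a ha b hb
  rw [intCubes_eq_image] at ha hb ⊢
  obtain ⟨x, hx, rfl⟩ := Finset.mem_image.1 ha
  obtain ⟨y, hy, rfl⟩ := Finset.mem_image.1 hb
  exact linked_lift_of_tLinked hS (X.2.2 x hx y hy)

/-- `X̂_K(X)` is non-empty. [cite: Balaban1987RG1, p.257 (bookkeeping)] -/
theorem intCubes_nonempty {Mc k K : ℕ} (X : (recordDomSys F Mc k K).Dom) : (intCubes F Mc k K X).Nonempty := by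
  rw [intCubes_eq_image]
  exact X.2.1.image _

/-- Off the wrap class `X̂_K(X)` is a member of the integer poset `P0CIntDom`. [cite: Balaban1987RG1, p.257, (1.21) p.264 (bookkeeping)] -/
theorem intCubes_mem_p0cIntDom {Mc k K : ℕ} {X : (recordDomSys F Mc k K).Dom} (hX : X ∉ recordWrapCtr F Mc k K) :
    (intCubes F Mc k K X).Nonempty ∧ B13ScaleTransfer.FaceConnected (intCubes F Mc k K X) :=
  ⟨intCubes_nonempty X, faceConnected_intCubes_of_not_mem_recordWrapCtr hX⟩

end Lift

/-! ## §2  Index geometry: a covered index read by the piece of `Y′` has its block in `X̂_K(Y′)` -/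

section Index

/-- **A covered level-`k` bond whose fine representative lies in the sites of `Y′`, and whose `L·Mc`-block is a CENTRED representative (a member of some `X̂_K(Y)`), has its block in
`X̂_K(Y′)`.** [cite: Balaban1987RG1, p.257, (1.21) p.264 (bookkeeping)] -/
theorem blockMap_mem_intCubes_of_embIter_mem_domSites {Mc k K : ℕ} (hMc : McGuard F Mc) (hK : recordK₀ F Mc k ≤ K) {Y Y' : (recordDomSys F Mc k K).Dom}
    {z : Fin 4 → ℤ} (hz : blockMap (F.L * Mc) z ∈ intCubes F Mc k K Y)
    (h : B15DeterminingSets.embIter k (coverAt (F.P K) k z) ∈ Sect2.domSites (F.P K) Mc (k + 1) Y') :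
    blockMap (F.L * Mc) z ∈ intCubes F Mc k K Y' := by
  have hk : k + 1 ≤ (F.P K).m + (F.P K).K := succ_le_m_add_K_of_recordK₀_le hK
  have hcube := cubeOfSite_blockOf_mem_of_embIter_mem_domSites hMc hK Y' (coverAt (F.P K) k z) h
  rw [blockOf_coverAt hk, cubeOfSite_coverAt hMc hK, blockMap_blockMap (P := F.P K), F.P_L] at hcube
  rw [intCubes_eq_image] at hz ⊢
  obtain ⟨x, -, hx⟩ := Finset.mem_image.1 hz
  have hmem : x ∈ (Y'.1 : Finset (TPt (F.P K).d (Sect2.domCount (F.P K) Mc (k + 1)))) := by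
    have e : proj (Sect2.domCount (F.P K) Mc (k + 1)) (blockMap (F.L * Mc) z) = x := by rw [← hx]; exact proj_valMinAbs x
    exact e ▸ hcube
  exact Finset.mem_image.2 ⟨x, hmem, hx⟩

end Index

/-! ## §3  The two strict down-sets enumerate the same subsets of `X̂_K(Y)` -/

section Sums

variable {M : Type*} [AddCommMonoid M]

/-- **Torus side**: a sum over the strict sub-domains `Y′ ⊊ Y` of `G(X̂_K(Y′))` is the sum of `G` over the strict subsets of `X̂_K(Y)`, for `G` vanishing at the empty and the
non-face-connected sets. [cite: Balaban1987RG1, (1.21) p.264, p.257] -/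
theorem sum_below_intCubes_eq_sum_ssubsets {Mc k K : ℕ} (Y : (recordDomSys F Mc k K).Dom) (G : Finset (Fin 4 → ℤ) → M)
    (hG : ∀ Yh, ¬ (Yh.Nonempty ∧ B13ScaleTransfer.FaceConnected Yh) → G Yh = 0) :
    ∑ Y' ∈ (p0cDown F Mc k K).below Y, G (intCubes F Mc k K Y') = ∑ Yh ∈ (intCubes F Mc k K Y).ssubsets, G Yh := by
  classical
  have hinj : Set.InjOn (intCubes F Mc k K) ↑((p0cDown F Mc k K).below Y) :=
    fun Y₁ _ Y₂ _ h => Subtype.ext (Finset.Subset.antisymm (subset_of_intCubes_subset h.le) (subset_of_intCubes_subset h.ge))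
  rw [← Finset.sum_image (f := G) hinj]
  refine Finset.sum_subset (fun Yh hYh => ?_) (fun Yh hYh hnot => ?_)
  · obtain ⟨Y', hY', rfl⟩ := Finset.mem_image.1 hYh
    have hss : (Y'.1 : Finset _) ⊂ Y.1 := ((p0cDown F Mc k K).mem_below_iff Y Y').1 hY'
    refine Finset.mem_ssubsets.2 (Finset.ssubset_iff_subset_ne.2 ⟨Finset.image_subset_image hss.subset, fun h => hss.ne ?_⟩)
    exact congrArg Subtype.val (Subtype.ext (Finset.Subset.antisymm (subset_of_intCubes_subset h.le) (subset_of_intCubes_subset h.ge)) : Y' = Y)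
  · refine hG Yh fun hne => hnot ?_
    have hsub : Yh ⊆ intCubes F Mc k K Y := (Finset.mem_ssubsets.1 hYh).subset
    let Y'' : (recordDomSys F Mc k K).Dom :=
      ⟨Yh.image (proj (Sect2.domCount (F.P K) Mc (k + 1))), ⟨hne.1.image _, tFaceConnected_image hne.2⟩⟩
    have hint : intCubes F Mc k K Y'' = Yh := by rw [intCubes_eq_image]; exact image_proj_image_valMinAbs hsub
    refine Finset.mem_image.2 ⟨Y'', ((p0cDown F Mc k K).mem_below_iff Y Y'').2 ?_, hint⟩
    refine Finset.ssubset_iff_subset_ne.2 ⟨image_proj_subset hsub, fun h => (Finset.mem_ssubsets.1 hYh).ne ?_⟩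
    rw [← hint]
    exact congrArg (intCubes F Mc k K) (Subtype.ext h : Y'' = Y)

/-- **Integer side**: a sum over the strict down-set of `X̂` in the integer poset of `G(X̂′)` is the sum of `G` over the strict subsets of `X̂`, for the same `G`. [folklore] -/
theorem sum_belowInt_eq_sum_ssubsets (X : P0CIntDom) (G : Finset (Fin 4 → ℤ) → M)
    (hG : ∀ Yh, ¬ (Yh.Nonempty ∧ B13ScaleTransfer.FaceConnected Yh) → G Yh = 0) :
    ∑ X' ∈ p0cIntDown.below X, G X'.1 = ∑ Yh ∈ X.1.ssubsets, G Yh := by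
  classical
  have hinj : Set.InjOn (fun X' : P0CIntDom => X'.1) ↑(p0cIntDown.below X) := fun _ _ _ _ h => Subtype.ext h
  rw [← Finset.sum_image (f := G) hinj]
  refine Finset.sum_subset (fun Yh hYh => ?_) (fun Yh hYh hnot => ?_)
  · obtain ⟨X', hX', rfl⟩ := Finset.mem_image.1 hYh
    exact Finset.mem_ssubsets.2 ((p0cIntDown.mem_below_iff X X').1 hX')
  · refine hG Yh fun hne => hnot ?_
    exact Finset.mem_image.2 ⟨⟨Yh, hne⟩, (p0cIntDown.mem_below_iff X ⟨Yh, hne⟩).2 (Finset.mem_ssubsets.1 hYh), rfl⟩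

end Sums

/-! ## §4  ★★ The (Z-bridge) of the pieces from the family-level bridge -/

section Bridge

/-- ★★ **THE (Z-bridge) ROW OF `P0CarrierClauses` FOR THE MÖBIUS PIECES**: off the centred wrap class, at covered indices whose `L·Mc`-blocks lie in `X̂_K(Y)`, the torus piece of the family
`T` at `Y` equals the integer piece of the family `TZ` at `X̂_K(Y)` read at the pulled-back pair — GIVEN the same identity for the FAMILIES (at every off-wrap domain), (P4-b) support for
`T` and (Z-supp) support for `TZ`.  Proof: the two Möbius recursions run over isomorphic posets (`Y′ ↦ X̂_K(Y′)`), and at indices outside a sub-window both pieces vanish.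
[cite: Balaban1987RG1, (1.21) p.264, (1.7) p.261] -/
theorem p0cPiece_bridge {Mc k K : ℕ} (hMc : McGuard F Mc) (hK : recordK₀ F Mc k ≤ K)
    (T : (recordDomSys F Mc k K).Dom → Sect2.CPair (F.P K) (MatA 2) → FluctIdx F k K → FluctIdx F k K → ℂ)
    (TZ : P0CIntDom → IntBondCfg → P0CIntIdx → P0CIntIdx → ℂ)
    (hTsupp : ∀ (X : (recordDomSys F Mc k K).Dom) (φ : Sect2.CPair (F.P K) (MatA 2)) (i j : FluctIdx F k K),
      (B15DeterminingSets.embIter k i.1.src ∉ Sect2.domSites (F.P K) Mc (k + 1) X ∨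
        B15DeterminingSets.embIter k j.1.src ∉ Sect2.domSites (F.P K) Mc (k + 1) X) → T X φ i j = 0)
    (hZsupp : ∀ (X : P0CIntDom) (f : IntBondCfg) (bi bj : (Fin 4 → ℤ) × Fin 4) (a a' : Fin 3),
      (blockMap (F.L * Mc) bi.1 ∉ X.1 ∨ blockMap (F.L * Mc) bj.1 ∉ X.1) → TZ X f (bi, a) (bj, a') = 0)
    (hfam : ∀ (Y : (recordDomSys F Mc k K).Dom) (hY : Y ∉ recordWrapCtr F Mc k K) (φ : Sect2.CPair (F.P K) (MatA 2)) (bi bj : (Fin 4 → ℤ) × Fin 4) (a a' : Fin 3),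
      blockMap (F.L * Mc) bi.1 ∈ intCubes F Mc k K Y → blockMap (F.L * Mc) bj.1 ∈ intCubes F Mc k K Y →
      T Y φ (coverBondAt (F.P K) k bi, a) (coverBondAt (F.P K) k bj, a') =
        TZ ⟨intCubes F Mc k K Y, intCubes_mem_p0cIntDom hY⟩ (pullPair F K φ) (bi, a) (bj, a'))
    (φ : Sect2.CPair (F.P K) (MatA 2)) :
    ∀ (Y : (recordDomSys F Mc k K).Dom), Y ∉ recordWrapCtr F Mc k K → ∀ (bi bj : (Fin 4 → ℤ) × Fin 4) (a a' : Fin 3),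
      blockMap (F.L * Mc) bi.1 ∈ intCubes F Mc k K Y → blockMap (F.L * Mc) bj.1 ∈ intCubes F Mc k K Y →
      p0cPiece F Mc k K T Y φ (coverBondAt (F.P K) k bi, a) (coverBondAt (F.P K) k bj, a') =
        p0cIntPiece TZ (intCubes F Mc k K Y) (pullPair F K φ) (bi, a) (bj, a') := by
  classical
  intro Y
  induction hn : (Y.1 : Finset (TPt (F.P K).d (Sect2.domCount (F.P K) Mc (k + 1)))).card using Nat.strong_induction_on generalizing Y with
  | _ n ih =>
    intro hY bi bj a a' hbi hbj
    -- unfold the torus recursion at `Y`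
    have eL : p0cPiece F Mc k K T Y = T Y - ∑ Y' ∈ (p0cDown F Mc k K).below Y, p0cPiece F Mc k K T Y' :=
      (p0cDown F Mc k K).mobius_eq T Y
    -- unfold the integer recursion at `X̂_K(Y)`
    have eR : p0cIntPiece TZ (intCubes F Mc k K Y) =
        TZ ⟨intCubes F Mc k K Y, intCubes_mem_p0cIntDom hY⟩ - ∑ X' ∈ p0cIntDown.below ⟨intCubes F Mc k K Y, intCubes_mem_p0cIntDom hY⟩, p0cIntDown.mobius TZ X' := by
      rw [p0cIntPiece_of_mem TZ ⟨intCubes F Mc k K Y, intCubes_mem_p0cIntDom hY⟩]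
      exact p0cIntDown.mobius_eq TZ _
    rw [eL, eR]
    simp only [Pi.sub_apply, Finset.sum_apply]
    rw [hfam Y hY φ bi bj a a' hbi hbj]
    congr 1
    -- the two strict down-set sums, both read as sums of `G` over the strict subsets of `X̂_K(Y)`
    set G : Finset (Fin 4 → ℤ) → ℂ := fun Yh => p0cIntPiece TZ Yh (pullPair F K φ) (bi, a) (bj, a') with hGdef
    have hG0 : ∀ Yh, ¬ (Yh.Nonempty ∧ B13ScaleTransfer.FaceConnected Yh) → G Yh = 0 := fun Yh h => p0cIntPiece_of_not TZ h _ _ _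
    -- torus side: termwise the piece of `Y′` at these indices is `G (X̂_K(Y′))`
    have hL : ∑ Y' ∈ (p0cDown F Mc k K).below Y, p0cPiece F Mc k K T Y' φ (coverBondAt (F.P K) k bi, a) (coverBondAt (F.P K) k bj, a') =
        ∑ Y' ∈ (p0cDown F Mc k K).below Y, G (intCubes F Mc k K Y') := by
      refine Finset.sum_congr rfl fun Y' hY' => ?_
      have hss : (Y'.1 : Finset _) ⊂ Y.1 := ((p0cDown F Mc k K).mem_below_iff Y Y').1 hY'
      have hY'w : Y' ∉ recordWrapCtr F Mc k K := not_mem_recordWrapCtr_of_subset hY hss.subset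
      by_cases hb : blockMap (F.L * Mc) bi.1 ∈ intCubes F Mc k K Y' ∧ blockMap (F.L * Mc) bj.1 ∈ intCubes F Mc k K Y'
      · exact ih _ (hn ▸ Finset.card_lt_card hss) Y' rfl hY'w bi bj a a' hb.1 hb.2
      · -- an index outside the sub-window: both pieces vanish
        have hor : blockMap (F.L * Mc) bi.1 ∉ intCubes F Mc k K Y' ∨ blockMap (F.L * Mc) bj.1 ∉ intCubes F Mc k K Y' := by
          by_contra hc
          push Not at hc
          exact hb hc
        have hTor : B15DeterminingSets.embIter k (coverBondAt (F.P K) k bi, a).1.src ∉ Sect2.domSites (F.P K) Mc (k + 1) Y' ∨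
            B15DeterminingSets.embIter k (coverBondAt (F.P K) k bj, a').1.src ∉ Sect2.domSites (F.P K) Mc (k + 1) Y' :=
          hor.imp (fun h1 h2 => h1 (blockMap_mem_intCubes_of_embIter_mem_domSites hMc hK hbi h2))
            (fun h1 h2 => h1 (blockMap_mem_intCubes_of_embIter_mem_domSites hMc hK hbj h2))
        rw [p0cPiece_support T hTsupp Y' φ _ _ hTor]
        exact (p0cIntPiece_support TZ (F.L * Mc) hZsupp _ _ bi bj a a' hor).symm
    -- integer side: termwise the Möbius piece of `X̂′` is `G X̂′`
    have hR : ∑ X' ∈ p0cIntDown.below ⟨intCubes F Mc k K Y, intCubes_mem_p0cIntDom hY⟩, p0cIntDown.mobius TZ X' (pullPair F K φ) (bi, a) (bj, a') =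
        ∑ X' ∈ p0cIntDown.below ⟨intCubes F Mc k K Y, intCubes_mem_p0cIntDom hY⟩, G X'.1 :=
      Finset.sum_congr rfl fun X' _ => by simp only [hGdef, p0cIntPiece_of_mem TZ X']
    rw [hL, hR, sum_below_intCubes_eq_sum_ssubsets Y G hG0, sum_belowInt_eq_sum_ssubsets _ G hG0]

end Bridge

end Summit.QuantumFields.YangMills.Theorems.BalabanUVNodesPortS1

end
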